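import Literature.AlgebraicGeometry.Resolution.ChowLemmaProofs
import Literature.AlgebraicGeometry.Motives.IntegralProjectiveSpace
import HarnessLib

/-!
# Chow's lemma over an affine base `Spec R` (integral form, closed immersion for proper schemes)

`Literature/AlgebraicGeometry/Resolution/ChowLemmaProofs` proves Chow's lemma in Görtz–Wedhorn's integral
form over a FIELD (`ChowLemmaProof.chowLemmaIntegral_aux`, discharging `ChowLemmaIntegral`). Its chart
argument (`ChowLemmaProof.isImmersion_ι_comp_snd`, `preimage_fst_le_preimage_snd`,
`isImmersion_of_iSup_preimage_eq_top`, `isIso_morphismRestrict_of_section`, `isIntegral_image`,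
`dense_and_isCompact_finset_inf`) is written for an arbitrary base; only three inputs were specific to
`Spec k`: quasi-projectivity of affine schemes of finite type, projectivity of products (Segre), and the
properness of `ℙⁿ`. This file supplies those over a commutative ring `R` and re-runs the printed proof:

* `ChowLemmaRing.projOver R n` — `ℙⁿ_R → Spec R` as an `R`-scheme (the tree's
  `ProjBaseChangeRing.projToSpec`, proper by `ProjBaseChangeRing.isProper_projToSpec`),
  `ChowLemmaRing.IsProjOver` (closed `R`-immersion into some `ℙⁿ_R`), `IsProjOver.isProper`,
  `IsProjOver.tensor` (via the ring-general Segre embedding `Motives.Segre.segre` of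
  `Literature/AlgebraicGeometry/Motives/SegreEmbedding`, Hartshorne II Ex. 4.9 / Stacks 01WD);
* `ChowLemmaRing.exists_immersion_projOver` — affine `R`-schemes of finite type are quasi-projective
  (`Spec (R[y]/I) ↪ 𝐀ⁿ_R = D₊(x₀) ⊆ ℙⁿ_R`; Görtz–Wedhorn §(12.15); `ProjectiveSpace.chartAlgEquiv`);
* `ChowLemmaRing.chow` — **Chow's lemma over `Spec R`, integral form** (Görtz–Wedhorn I, Thm. 13.100 with
  (2); The Stacks Project, Tag 02O2 for `S = Spec R`): for `f : X → Spec R` separated of finite type with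
  `X` integral there are an integral `X'`, a proper surjective `π : X' → X`, an immersion
  `ι : X' → ℙⁿ_R` over `R` and a dense open `U ⊆ X` with `π⁻¹(U)` dense and `π⁻¹(U) ≅ U`;
* `ChowLemmaRing.chow_proper` — **for `f` proper, `ι` is a closed immersion** (Thm. 13.100 (1): `X'` is
  proper over `R`, so the immersion `X' → ℙⁿ_R` is proper, hence a closed immersion).

No Noetherian hypothesis is needed on this route. Everything is proved; no named facts. Used by
`Literature/AlgebraicGeometry/Motives/GoodReduction*` (Zariski's connectedness theorem for smooth proper
models over a discrete valuation ring, via a projective cover `X' → 𝒳`).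

## References

* U. Görtz, T. Wedhorn, *Algebraic Geometry I: Schemes*, 2nd ed. (2020): §(12.15) p. 440; Theorem 13.100
  (Lemma of Chow), PDF p. 529. [GortzWedhorn2020]
* The Stacks Project, Tag 02O2 (Cohomology of Schemes, Lemma 30.18.1, Chow's lemma); Tag 01WD (Segre).
  [StacksProject]
* R. Hartshorne, *Algebraic Geometry*, GTM 52 (1977): II Ex. 4.10 (Chow's Lemma), II Thm. 4.9.
  [Hartshorne1977]
-/

universe u

open CategoryTheory Limits TopologicalSpace AlgebraicGeometry MonoidalCategory CartesianMonoidalCategory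

noncomputable section

attribute [local instance] MvPolynomial.gradedAlgebra
  Literature.AlgebraicGeometry.Motives.ProjBaseChange.algebraBase

namespace Literature.AlgebraicGeometry.Resolution

namespace ChowLemmaRing

open MvPolynomial HomogeneousLocalization

variable (R : Type u) [CommRing R]

/-- Projective `n`-space over the commutative ring `R` as an `R`-scheme: `Proj R[x₀, …, xₙ] → Spec R`
(the tree's `ProjBaseChangeRing.projToSpec`). [folklore] -/
def projOver (n : ℕ) : Motives.SchemeOver R :=
  Over.mk (Motives.ProjBaseChangeRing.projToSpec (Fin (n + 1)) R)

variable {R}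

/-- An `R`-scheme is *projective over `R`* if it admits a closed `R`-immersion into some `ℙⁿ_R`
(Hartshorne II.4; Stacks 01W7, for the affine base `Spec R`). [folklore] -/
def IsProjOver (X : Motives.SchemeOver R) : Prop :=
  ∃ (n : ℕ) (ι : X ⟶ projOver R n), IsClosedImmersion ι.left

/-- `ℙⁿ_R → Spec R` is proper (tree: `ProjBaseChangeRing.isProper_projToSpec`). [folklore] -/
instance isProper_projOver_hom (n : ℕ) : IsProper (projOver R n).hom :=
  Motives.ProjBaseChangeRing.isProper_projToSpec (Fin (n + 1)) R

/-- Projective `R`-schemes are proper over `R`. [folklore] -/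
theorem IsProjOver.isProper {X : Motives.SchemeOver R} (h : IsProjOver X) : IsProper X.hom := by
  obtain ⟨n, ι, hι⟩ := h
  rw [← Over.w ι]
  infer_instance

/-- Closed immersions of `R`-schemes are stable under the fibre product over `R` (Stacks 01QR). [folklore] -/
theorem isClosedImmersion_tensorHom_left {X Y X' Y' : Motives.SchemeOver R} (f : X ⟶ X') (g : Y ⟶ Y')
    [IsClosedImmersion f.left] [IsClosedImmersion g.left] : IsClosedImmersion (f ⊗ₘ g).left := by
  change IsClosedImmersion (pullback.map X.hom Y.hom X'.hom Y'.hom f.left g.left (𝟙 _) (by simp) (by simp))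
  rw [pullback_map_eq_pullbackFstFstIso_inv]
  infer_instance

/-- The Segre embedding `ℙⁿ_R ×_R ℙᵐ_R ↪ ℙ^{nm+n+m}_R` over the ring `R`, as a morphism of `R`-schemes
(the tree's `Segre.segre`, ring-general). [folklore] -/
def segreOver (n m : ℕ) : projOver R n ⊗ projOver R m ⟶ projOver R (n * m + n + m) :=
  Over.homMk (Motives.Segre.segre R (Motives.segreIndexEquiv n m))
    (Motives.Segre.segre_toSpec R (Motives.segreIndexEquiv n m))

/-- The Segre embedding over `R` is a closed immersion (Hartshorne II Ex. 4.9; Stacks 01WD). [folklore] -/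
instance isClosedImmersion_segreOver_left (n m : ℕ) : IsClosedImmersion (segreOver (R := R) n m).left :=
  Motives.Segre.isClosedImmersion_segre R (Motives.segreIndexEquiv n m)

/-- Products of projective `R`-schemes are projective (Segre). [folklore] -/
theorem IsProjOver.tensor {X Y : Motives.SchemeOver R} (hX : IsProjOver X) (hY : IsProjOver Y) :
    IsProjOver (X ⊗ Y) := by
  obtain ⟨n, ι, hι⟩ := hX
  obtain ⟨m, κ, hκ⟩ := hY
  refine ⟨n * m + n + m, (ι ⊗ₘ κ) ≫ segreOver n m, ?_⟩
  have := isClosedImmersion_tensorHom_left ι κ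
  change IsClosedImmersion ((ι ⊗ₘ κ).left ≫ (segreOver n m).left)
  infer_instance

/-- **Affine `R`-schemes of finite type are quasi-projective over `R`**: `Spec (R[y₁,…,yₙ]/I) ↪ 𝐀ⁿ_R ≅ D₊(x₀) ⊆ ℙⁿ_R`
(Görtz–Wedhorn §(12.15); the ring version of `ChowLemmaProof.exists_immersion_projectiveSpace`).
[cite: GortzWedhorn2020, §(12.15) p. 440] -/
theorem exists_immersion_projOver {Y : Scheme.{u}} [IsAffine Y] (g : Y ⟶ Spec (.of R))
    [LocallyOfFiniteType g] :
    ∃ (n : ℕ) (ρ : Y ⟶ (projOver R n).left), IsImmersion ρ ∧ ρ ≫ (projOver R n).hom = g := by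
  let ψ : R →+* Γ(Y, ⊤) := g.appTop.hom.comp (Scheme.ΓSpecIso (.of R)).inv.hom
  have hψ : ψ.FiniteType := by
    have h1 : g.appTop.hom.FiniteType :=
      (HasRingHomProperty.iff_of_isAffine (P := @LocallyOfFiniteType)).mp ‹_›
    refine h1.comp (RingHom.FiniteType.of_surjective _ ?_)
    exact (Scheme.ΓSpecIso (.of R)).symm.commRingCatIsoToRingEquiv.surjective
  letI : Algebra R Γ(Y, ⊤) := ψ.toAlgebra
  have hft : Algebra.FiniteType R Γ(Y, ⊤) := hψ
  obtain ⟨n, θ, hθ⟩ := Algebra.FiniteType.iff_quotient_mvPolynomial''.mp hft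
  let e := Motives.ProjectiveSpace.chartAlgEquiv R (0 : Fin (n + 1))
  let φ : Away (homogeneousSubmodule (Fin (n + 1)) R) (X 0) →+* Γ(Y, ⊤) :=
    θ.toRingHom.comp e.toRingEquiv.toRingHom
  have hφ : Function.Surjective φ := hθ.comp e.surjective
  have hφψ : φ.comp (algebraMap R _) = ψ := by
    ext c
    change θ (e (algebraMap R _ c)) = ψ c
    rw [e.commutes, θ.commutes]
    rfl
  haveI : IsClosedImmersion (Spec.map (CommRingCat.ofHom φ)) :=
    IsClosedImmersion.spec_of_surjective _ hφ
  let ρ : Y ⟶ Proj (homogeneousSubmodule (Fin (n + 1)) R) := Y.isoSpec.hom ≫ Spec.map (CommRingCat.ofHom φ) ≫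
    Proj.awayι (homogeneousSubmodule (Fin (n + 1)) R) (X 0) (Motives.ProjectiveSpace.X_mem 0) zero_lt_one
  have hρ : IsImmersion ρ := inferInstance
  refine ⟨n, ρ, hρ, ?_⟩
  change (_ ≫ _ ≫ _) ≫ Motives.ProjBaseChangeRing.projToSpec (Fin (n + 1)) R = g
  rw [Category.assoc, Category.assoc, Motives.ProjBaseChangeRing.awayι_projToSpec, ← Spec.map_comp,
    ← CommRingCat.ofHom_comp, hφψ]
  have hψ' : CommRingCat.ofHom ψ = (Scheme.ΓSpecIso (.of R)).inv ≫ g.appTop := rfl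
  rw [hψ', Spec.map_comp, Scheme.isoSpec_hom, ← Scheme.toSpecΓ_naturality_assoc, ← SpecMap_ΓSpecIso_hom,
    ← Spec.map_comp, Iso.inv_hom_id, Spec.map_id, Category.comp_id]

/-- Finite families of projective `R`-schemes have projective weak products (ring version of
`ChowLemmaProof.exists_weakProd`). [folklore] -/
theorem exists_weakProd : ∀ (m : ℕ) (P : Fin (m + 1) → Motives.SchemeOver R), (∀ i, IsProjOver (P i)) →
    ∃ (Q : Motives.SchemeOver R) (q : ∀ i, Q ⟶ P i), IsProjOver Q ∧
      ∀ (T : Motives.SchemeOver R) (t : ∀ i, T ⟶ P i), ∃ r : T ⟶ Q, ∀ i, r ≫ q i = t i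
  | 0, P, hP => by
    refine ⟨P 0, fun i => Fin.cases (motive := fun i => P 0 ⟶ P i) (𝟙 (P 0)) (fun j => j.elim0) i,
      hP 0, fun T t => ⟨t 0, fun i => ?_⟩⟩
    refine Fin.cases ?_ (fun j => j.elim0) i
    simp
  | m + 1, P, hP => by
    obtain ⟨Q', q', hQ', hlift⟩ := exists_weakProd m (fun j => P j.succ) fun j => hP j.succ
    refine ⟨P 0 ⊗ Q', fun i => Fin.cases (motive := fun i => P 0 ⊗ Q' ⟶ P i) (fst (P 0) Q')
      (fun j => snd (P 0) Q' ≫ q' j) i, (hP 0).tensor hQ', fun T t => ?_⟩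
    obtain ⟨r', hr'⟩ := hlift T fun j => t j.succ
    refine ⟨lift (t 0) r', fun i => ?_⟩
    refine Fin.cases ?_ (fun j => ?_) i
    · simp
    · simp [hr']

/-- **Chow's lemma over an affine base, integral form with a closed immersion for proper `X`**
(Görtz–Wedhorn I, Thm. 13.100 with (1), (2); The Stacks Project, Tag 02O2, for `S = Spec R`): for a
separated `R`-scheme of finite type `f : X → Spec R` with `X` integral there are `n`, an integral
`X'`, a proper surjective `π : X' → X`, an immersion `ι : X' → ℙⁿ_R` over `R` and a dense open `U ⊆ X`
with `π⁻¹(U)` dense in `X'` and `π⁻¹(U) → U` an isomorphism. The proof is that of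
`ChowLemmaProof.chowLemmaIntegral_aux` (the base-specific inputs being `exists_immersion_projOver`,
`exists_weakProd` and the properness of `ℙⁿ_R`). [cite: GortzWedhorn2020, Thm 13.100] -/
theorem chow (X : Scheme.{u}) (f : X ⟶ Spec (.of R)) [IsSeparated f] [LocallyOfFiniteType f]
    [QuasiCompact f] [IsIntegral X] :
    ∃ (n : ℕ) (X' : Scheme.{u}) (π : X' ⟶ X) (ι : X' ⟶ (projOver R n).left),
      IsIntegral X' ∧ IsImmersion ι ∧ IsProper π ∧ Surjective π ∧
        ι ≫ (projOver R n).hom = π ≫ f ∧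
          ∃ U : X.Opens, Dense (U : Set X) ∧ Dense ((π ⁻¹ᵁ U : X'.Opens) : Set X') ∧ IsIso (π ∣_ U) := by
  classical
  haveI : CompactSpace X := QuasiCompact.compactSpace_of_compactSpace f
  haveI : X.IsSeparated := (HasAffineProperty.iff_of_isAffine (P := @IsSeparated)).mp ‹_›
  let 𝒰 := X.affineCover.finiteSubcover
  obtain ⟨x₀⟩ := (inferInstance : Nonempty X)
  haveI : Nonempty 𝒰.I₀ := ⟨𝒰.idx x₀⟩
  obtain ⟨m, hm⟩ := Nat.exists_eq_succ_of_ne_zero (Fintype.card_ne_zero (α := 𝒰.I₀))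
  let e : Fin (m + 1) ≃ 𝒰.I₀ := (Fintype.equivFinOfCardEq hm).symm
  let Xc : Fin (m + 1) → X.Opens := fun c => (𝒰.f (e c)).opensRange
  have hXc : ∀ c, IsAffineOpen (Xc c) := fun c => isAffineOpen_opensRange _
  have hXc' : ∀ c, ((Xc c : Set X)).Nonempty := fun c =>
    ⟨(e c).1, by
      change (e c).1 ∈ Set.range (𝒰.f (e c))
      rw [Scheme.OpenCover.finiteSubcover_f]
      exact X.affineCover.covers _⟩
  have hcov : (⨆ c, Xc c) = ⊤ := by
    rw [← top_le_iff]
    rintro x -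
    refine Opens.mem_iSup.mpr ⟨e.symm (𝒰.idx x), ?_⟩
    change x ∈ Set.range (𝒰.f (e (e.symm (𝒰.idx x))))
    rw [e.apply_symm_apply]
    exact 𝒰.covers x
  let U : X.Opens := Finset.univ.inf Xc
  have hUle : ∀ c, U ≤ Xc c := fun c => Finset.inf_le (Finset.mem_univ c)
  obtain ⟨hUdense, hUcpt⟩ := ChowLemmaProof.dense_and_isCompact_finset_inf Xc hXc hXc' Finset.univ
  haveI : CompactSpace U.toScheme := isCompact_iff_compactSpace.mp hUcpt
  haveI : Nonempty U.toScheme := by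
    obtain ⟨x, hx⟩ := hUdense.nonempty
    exact ⟨⟨x, hx⟩⟩
  haveI : IsIntegral U.toScheme := isIntegral_of_isOpenImmersion U.ι
  have himm : ∀ c, ∃ (n : ℕ) (ρ : (Xc c).toScheme ⟶ (projOver R n).left),
      IsImmersion ρ ∧ ρ ≫ (projOver R n).hom = (Xc c).ι ≫ f := fun c =>
    haveI : IsAffine (Xc c) := hXc c
    exists_immersion_projOver ((Xc c).ι ≫ f)
  choose n ρ hρ hρf using himm
  haveI : ∀ c, IsImmersion (ρ c) := hρ
  haveI : ∀ c, Scheme.IsSeparated (projOver R (n c)).left := fun c =>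
    inferInstanceAs (Scheme.IsSeparated (Proj (homogeneousSubmodule (Fin (n c + 1)) R)))
  haveI : ∀ c, CompactSpace (Xc c).toScheme := fun c => isCompact_iff_compactSpace.mp (hXc c).isCompact
  haveI : ∀ c, QuasiCompact (ρ c) := fun c => inferInstance
  let Pc : Fin (m + 1) → Motives.SchemeOver R := fun c => Over.mk ((ρ c).imageι ≫ (projOver R (n c)).hom)
  have hPc : ∀ c, IsProjOver (Pc c) := fun c =>
    ⟨n c, Over.homMk (ρ c).imageι rfl, inferInstanceAs (IsClosedImmersion (ρ c).imageι)⟩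
  haveI : ∀ c, IsSeparated ((ρ c).imageι ≫ (projOver R (n c)).hom) := fun c => inferInstance
  obtain ⟨Q, qc, hQ, hlift⟩ := exists_weakProd m Pc hPc
  haveI : IsProper Q.hom := hQ.isProper
  let Uk : Motives.SchemeOver R := Over.mk (U.ι ≫ f)
  let t : ∀ c, Uk ⟶ Pc c := fun c => Over.homMk (X.homOfLE (hUle c) ≫ (ρ c).toImage) (by
    change (X.homOfLE (hUle c) ≫ (ρ c).toImage) ≫ (ρ c).imageι ≫ (projOver R (n c)).hom = U.ι ≫ f
    rw [Category.assoc, Scheme.Hom.toImage_imageι_assoc, hρf, Scheme.homOfLE_ι_assoc])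
  obtain ⟨r, hr⟩ := hlift Uk t
  have hw : U.ι ≫ f = r.left ≫ Q.hom := (Over.w r).symm
  let hh : U.toScheme ⟶ pullback f Q.hom := pullback.lift U.ι r.left hw
  haveI : IsImmersion hh := by
    have : IsImmersion (hh ≫ pullback.fst f Q.hom) := by rw [pullback.lift_fst]; infer_instance
    exact IsImmersion.of_comp hh (pullback.fst f Q.hom)
  haveI : QuasiCompact hh := by
    have : QuasiCompact (hh ≫ pullback.fst f Q.hom) := by rw [pullback.lift_fst]; infer_instance
    exact QuasiCompact.of_comp hh (pullback.fst f Q.hom)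
  haveI : IsIntegral hh.image := ChowLemmaProof.isIntegral_image hh
  have hsec : hh.toImage ≫ hh.imageι ≫ pullback.fst f Q.hom = U.ι := by
    rw [Scheme.Hom.toImage_imageι_assoc, pullback.lift_fst]
  haveI : Surjective (hh.imageι ≫ pullback.fst f Q.hom) := by
    haveI : IsDominant U.ι := Opens.isDominant_ι hUdense
    haveI : IsDominant (hh.toImage ≫ hh.imageι ≫ pullback.fst f Q.hom) := by rw [hsec]; infer_instance
    haveI : IsDominant (hh.imageι ≫ pullback.fst f Q.hom) := IsDominant.of_comp hh.toImage _
    exact surjective_of_isDominant_of_isClosed_range _ (Scheme.Hom.isClosedMap _).isClosed_range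
  obtain ⟨hiso, hdense⟩ := ChowLemmaProof.isIso_morphismRestrict_of_section (hh.imageι ≫ pullback.fst f Q.hom)
    U hh.toImage hsec
  have hι' : IsImmersion (hh.imageι ≫ pullback.snd f Q.hom) := by
    have hrc : ∀ c, (ρ c).toImage ≫ (ρ c).imageι ≫ (projOver R (n c)).hom = (Xc c).ι ≫ f := fun c => by
      rw [Scheme.Hom.toImage_imageι_assoc, hρf]
    have hqc : ∀ c, (qc c).left ≫ (ρ c).imageι ≫ (projOver R (n c)).hom = Q.hom := fun c => Over.w (qc c)
    have hu₁ : ∀ c, X.homOfLE (hUle c) ≫ (Xc c).ι = hh.toImage ≫ hh.imageι ≫ pullback.fst f Q.hom := fun c => by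
      rw [hsec, Scheme.homOfLE_ι]
    have hu₂ : ∀ c, hh.toImage ≫ hh.imageι ≫ pullback.snd f Q.hom ≫ (qc c).left =
        X.homOfLE (hUle c) ≫ (ρ c).toImage := fun c => by
      have hrc' := congr($(hr c).left)
      simp only [Over.comp_left, Over.homMk_left, t] at hrc'
      rw [Scheme.Hom.toImage_imageι_assoc, pullback.lift_snd_assoc]
      exact hrc'
    refine ChowLemmaProof.isImmersion_of_iSup_preimage_eq_top _
      (fun c => (qc c).left ⁻¹ᵁ (ρ c).toImage.opensRange) ?_ fun c =>
      ChowLemmaProof.isImmersion_ι_comp_snd (Pc := (ρ c).image) f Q.hom hh.imageι hh.toImage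
        ((ρ c).imageι ≫ (projOver R (n c)).hom) (qc c).left (hqc c) (Xc c) (ρ c).toImage (hrc c)
        (X.homOfLE (hUle c)) (hu₁ c) (hu₂ c)
    rw [← top_le_iff]
    calc (⊤ : hh.image.Opens)
        = (hh.imageι ≫ pullback.fst f Q.hom) ⁻¹ᵁ (⨆ c, Xc c) := by rw [hcov]; rfl
      _ = ⨆ c, (hh.imageι ≫ pullback.fst f Q.hom) ⁻¹ᵁ (Xc c) := Scheme.Hom.preimage_iSup _ _
      _ ≤ ⨆ c, (hh.imageι ≫ pullback.snd f Q.hom) ⁻¹ᵁ ((qc c).left ⁻¹ᵁ (ρ c).toImage.opensRange) :=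
          iSup_mono fun c => ChowLemmaProof.preimage_fst_le_preimage_snd (Pc := (ρ c).image) f Q.hom hh.imageι
            hh.toImage ((ρ c).imageι ≫ (projOver R (n c)).hom) (qc c).left (hqc c) (Xc c)
            (ρ c).toImage (hrc c) (X.homOfLE (hUle c)) (hu₁ c) (hu₂ c)
  obtain ⟨N, ε, hε⟩ := hQ
  haveI := hι'
  refine ⟨N, hh.image, hh.imageι ≫ pullback.fst f Q.hom, (hh.imageι ≫ pullback.snd f Q.hom) ≫ ε.left,
    inferInstance, inferInstance, inferInstance, inferInstance, ?_, U, hUdense, hdense, hiso⟩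
  rw [Category.assoc, Category.assoc, Over.w ε, Category.assoc, ← pullback.condition]

/-- **Chow's lemma over `Spec R` for proper `X`, with a closed immersion**: if moreover `f : X → Spec R`
is proper, then in `chow` the morphism `ι : X' → ℙⁿ_R` is a closed immersion (an immersion with
closed image: `X'` is proper over `R` and `ℙⁿ_R → Spec R` is separated; Görtz–Wedhorn I, Thm. 13.100 (1)).
[cite: GortzWedhorn2020, Thm 13.100] -/
theorem chow_proper (X : Scheme.{u}) (f : X ⟶ Spec (.of R)) [IsProper f] [IsIntegral X] :
    ∃ (n : ℕ) (X' : Scheme.{u}) (π : X' ⟶ X) (ι : X' ⟶ (projOver R n).left),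
      IsIntegral X' ∧ IsClosedImmersion ι ∧ IsProper π ∧ Surjective π ∧
        ι ≫ (projOver R n).hom = π ≫ f ∧
          ∃ U : X.Opens, Dense (U : Set X) ∧ Dense ((π ⁻¹ᵁ U : X'.Opens) : Set X') ∧ IsIso (π ∣_ U) := by
  obtain ⟨n, X', π, ι, h1, h2, h3, h4, h5, hU⟩ := chow X f
  refine ⟨n, X', π, ι, h1, ?_, h3, h4, h5, hU⟩
  haveI : IsProper (ι ≫ (projOver R n).hom) := by rw [h5]; infer_instance
  haveI : IsProper ι := IsProper.of_comp ι (projOver R n).hom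
  exact IsClosedImmersion.of_isPreimmersion ι ι.isClosedMap.isClosed_range

end ChowLemmaRing

end Literature.AlgebraicGeometry.Resolution
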